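import Literature.MathematicalPhysics.QuantumLattice.HubbardTPPBoxHamiltonian
import Literature.MathematicalPhysics.QuantumLattice.HubbardOpenBoxEDUpperCertificateSupp
import HarnessLib

/-!
# Kernel-checked open-cluster UPPER certificates, third-neighbour edition: the coded axial range-2 adjacency, the fifth
# quadratic form `SHop (ax2AdjCode b)`, and SOUNDNESS `sound₆` — one integer cluster vector certifies a `t–t'–t''` witness plane
# for the object-M variational density `tiGroundEnergyDensityAt (hubbardTT'T''FermionInteraction 1 t' t'' U) R`

Topic `Literature/MathematicalPhysics/QuantumLattice` (family `hubbard`). Extension of hubbard-box-p2's device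
`HubbardOpenBoxEDUpperCertificate{,Fast,Split,Nested,Supp}` (packed integer cluster vector `UpperCert`, forms `SHop`, `SD`, `NN`, soundness
`sound … sound₅` for the `t–t'` witness planes of `energyDensityTT'`) by ONE more form — the third-neighbour hopping sum
`SHop (ax2AdjCode b)` — and the soundness theorem that feeds the five forms to
`tiGroundEnergyDensityAt_hubbardTT'T''_le_of_openBox_witness_planes` (`HubbardTPPBoxHamiltonian`, hubbard-box-p3 g15): the t″-EXACT cap plane
of object M from a kernel certificate. Written for the S1/S2 seam of the Hubbard material-oracle programme (object-M words paid the kinematic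
`(16/π²)|t''|` on the cap side; with this file a certificate file adds `sA2` blocks and gets the exact `t''` slope).

* `ax2AdjCode b P Q` — coded third-neighbour adjacency of row-major ranks (`|Δrow| = 2, Δcol = 0` or `Δrow = 0, |Δcol| = 2`);
  `ax2AdjCode_siteRank : … = true ↔ (rectBoxAxial2Graph a b).Adj x y`.
* `axial2_hamiltonian_mulVec_codedVec`, `star_dotProduct_axial2_mulVec_codedVec`: `⟨φ_f, hamiltonian (rectBoxAxial2Graph a b) 1 0 φ_f⟩ = −SHop (ax2AdjCode b)`.
* **`UpperCert.sound₆`** (split grammar `supp₅ / NN₃ / SHop₄ / SD₃`, sides `q₀+1, q₁+1`): support test + `0 < NN₃` + the SIX rational inequalities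
  `−SHop₄ nn ≤ EK·NN`, `∓SHop₄ diag ≤ EP·NN / EM·NN`, `∓SHop₄ ax2 ≤ E3P·NN / E3M·NN`, `SD₃ ≤ ED·NN` ⟹ for all `t', t''`, `U ≥ 0`, `R ≥ 2`:
  `e^M(1,t',t'',U; N/|C|) ≤ (EK + max(t'EP, −t'EM) + max(t''E3P, −t''E3M) + U·ED)/|C|`.

Everything is PROVED; one definition with body (`ax2AdjCode`); no named fact, no number, no `sorry`.

## Tree / Mathlib search

REUSED: `UpperCert`, `fAt`, `SHop/SD/NN(₃/₄)`, `supp₅(_eq)`, `SHop₃/₄_eq`, `SD₃_eq`, `NN₃_eq`, `codedVec`, `star_dotProduct_mulVec_codedVec`, `star_dotProduct_codedVec`,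
`isNParticle_codedVec`, `hamiltonian_mulVec_apply`, `sum_hop_mulVec_code`, `sum_univ_code`, `siteRank_div_mod`, `nnAdjCode_siteRank` (pattern), `allNest_eq`,
`of_allNat` (`HubbardOpenBoxEDUpperCertificate*`, `HubbardOpenBoxCodedHamiltonian`, hubbard-box-p2); `rectBoxAxial2Graph`, `line2Adj`, `hubbardOpenBoxTT'T''`,
`tiGroundEnergyDensityAt_hubbardTT'T''_le_of_openBox_witness_planes` (`HubbardTPPBoxHamiltonian`).

## References

* H. Q. Lin, J. E. Gubernatis, Comput. Phys. 7 (1993) 400, §II (occupation codes, hopping words). [cite: LinGubernatis1993, §II]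
* D. Ruelle, *Statistical Mechanics: Rigorous Results* (1969), §3.3 (cluster variational principle). [cite: Ruelle1969, §3.3]
* E. Pavarini et al., PRL 87 (2001) 047003, eq. (1) (`t''`). [cite: PavariniEtAl2001, eq. (1)]
* A. Neumaier, Acta Numerica 13 (2004) 271, §11 (rigorous verification by exact arithmetic). [cite: Neumaier2004CompleteSearch, §11]
-/

namespace Literature.MathematicalPhysics.QuantumLattice

namespace OccupationCode

open Finset Matrix HubbardWave0 ThermodynamicLimit

/-! ### §1 The coded third-neighbour adjacency -/

/-- **Third-neighbour (axial range-2) adjacency of the sites of rank `P, Q`** of the open `a × b` box (row-major ranks):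
same column and rows two apart, or same row and columns two apart. [cite: PavariniEtAl2001, eq. (1)] -/
def ax2AdjCode (b P Q : ℕ) : Bool :=
  decide ((P % b = Q % b ∧ line2Adj (P / b) (Q / b)) ∨ (P / b = Q / b ∧ line2Adj (P % b) (Q % b)))

variable {a b : ℕ}

/-- The coded third-neighbour adjacency is the third-neighbour box graph `rectBoxAxial2Graph a b`. [cite: PavariniEtAl2001, eq. (1)] -/
theorem ax2AdjCode_siteRank (x y : Fin a ×ₗ Fin b) :
    ax2AdjCode b (siteRank x) (siteRank y) = true ↔ (rectBoxAxial2Graph a b).Adj x y := by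
  obtain ⟨h1, h2⟩ := siteRank_div_mod x
  obtain ⟨h3, h4⟩ := siteRank_div_mod y
  rw [ax2AdjCode, decide_eq_true_iff, h1, h2, h3, h4]
  change _ ↔ ((ofLex x).2 = (ofLex y).2 ∧ _) ∨ ((ofLex x).1 = (ofLex y).1 ∧ _)
  rw [Fin.ext_iff, Fin.ext_iff]

/-! ### §2 The third-neighbour form of a coded vector -/

/-- **The third-neighbour hopping Hamiltonian on a coded vector, in code form**:
`(hamiltonian (rectBoxAxial2Graph a b) 1 0 · φ_f)(s) = −(openBoxHopApply ax2 f)(code s)`. [cite: LinGubernatis1993, §II] -/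
theorem axial2_hamiltonian_mulVec_codedVec (f : ℕ → ℤ) (s : Finset (Orb (Fin a ×ₗ Fin b))) :
    (hamiltonian (rectBoxAxial2Graph a b) 1 0 *ᵥ codedVec f) s = -((openBoxHopApply (ax2AdjCode b) (a * b) (code s) f : ℤ) : ℂ) := by
  rw [hamiltonian_mulVec_apply, sum_hop_mulVec_code (rectBoxAxial2Graph a b) (ax2AdjCode b) ax2AdjCode_siteRank f s]
  simp

/-- **`⟨φ_f, hamiltonian (rectBoxAxial2Graph a b) 1 0 φ_f⟩ = −SHop ax2`** — the fifth quadratic form of the certificate.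
[cite: LinGubernatis1993, §II] -/
theorem UpperCert.star_dotProduct_axial2_mulVec_codedVec (C : UpperCert) (a b : ℕ) :
    star (codedVec (a := a) (b := b) C.fAt) ⬝ᵥ (hamiltonian (rectBoxAxial2Graph a b) 1 0 *ᵥ codedVec C.fAt) =
      ((-(C.SHop (ax2AdjCode b) a b : ℝ) : ℝ) : ℂ) := by
  rw [dotProduct]
  have hterm : ∀ s : Finset (Orb (Fin a ×ₗ Fin b)),
      (star (codedVec (a := a) (b := b) C.fAt)) s * (hamiltonian (rectBoxAxial2Graph a b) 1 0 *ᵥ codedVec C.fAt) s =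
        (((fun m : ℕ => -((if C.fAt m = 0 then 0 else C.fAt m * openBoxHopApply (ax2AdjCode b) (a * b) m C.fAt : ℤ) : ℝ)) (code s) : ℝ) : ℂ) := by
    intro s
    rw [axial2_hamiltonian_mulVec_codedVec]
    simp only [codedVec, Pi.star_apply, RCLike.star_def, map_intCast]
    by_cases h0 : C.fAt (code s) = 0
    · simp [h0]
    · simp only [h0, if_false]
      push_cast
      ring
  simp_rw [hterm]
  rw [sum_univ_code (fun m => (((-((if C.fAt m = 0 then 0 else C.fAt m * openBoxHopApply (ax2AdjCode b) (a * b) m C.fAt : ℤ) : ℝ)) : ℝ) : ℂ))]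
  rw [UpperCert.SHop, sumNat_eq, sumNat_eq]
  push_cast
  simp only [Finset.sum_neg_distrib]

/-! ### §3 Soundness: five forms ⇒ the `t–t'–t''` witness plane of object M -/

/-- **SOUNDNESS, third-neighbour edition (`sound₆`).** For a packed integer cluster vector `C` on the open `(q₀+1) × (q₁+1)` box, in the
split grammar of the certificate files (`B^L = 4^{|C|}`): the short-circuiting support test, `0 < ‖φ‖²`, and the six rational inequalities
`−SHop₄ nn ≤ EK·‖φ‖²`, `−SHop₄ diag ≤ EP·‖φ‖²`, `SHop₄ diag ≤ EM·‖φ‖²`, `−SHop₄ ax2 ≤ E3P·‖φ‖²`, `SHop₄ ax2 ≤ E3M·‖φ‖²`, `SD₃ ≤ ED·‖φ‖²`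
certify, for EVERY `t', t''`, every `U ≥ 0` and every range parameter `R ≥ 2`, the t″-EXACT cap plane
`e^M(1,t',t'',U; N/|C|) ≤ (EK + max(t'EP, −t'EM) + max(t''E3P, −t''E3M) + U·ED)/|C|` of the object-M variational density
(`tiGroundEnergyDensityAt_hubbardTT'T''_le_of_openBox_witness_planes` on the normalised coded vector). [cite: Ruelle1969, §3.3] [cite: PavariniEtAl2001, eq. (1)] -/
theorem UpperCert.sound₆ (C : UpperCert) {q : Fin 2 → ℕ} {N B L : ℕ} {EK EP EM E3P E3M ED : ℚ}
    (hBL : B ^ L = 4 ^ ((q 0 + 1) * (q 1 + 1)))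
    (hsupp : C.supp₅ (q 0 + 1) (q 1 + 1) N B L = true) (hNN : 0 < C.NN₃ B L)
    (hK : (-(C.SHop₄ (nnAdjCode (q 1 + 1)) (q 0 + 1) (q 1 + 1) B L) : ℚ) ≤ EK * C.NN₃ B L)
    (hP : (-(C.SHop₄ (diagAdjCode (q 1 + 1)) (q 0 + 1) (q 1 + 1) B L) : ℚ) ≤ EP * C.NN₃ B L)
    (hM : ((C.SHop₄ (diagAdjCode (q 1 + 1)) (q 0 + 1) (q 1 + 1) B L) : ℚ) ≤ EM * C.NN₃ B L)
    (h3P : (-(C.SHop₄ (ax2AdjCode (q 1 + 1)) (q 0 + 1) (q 1 + 1) B L) : ℚ) ≤ E3P * C.NN₃ B L)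
    (h3M : ((C.SHop₄ (ax2AdjCode (q 1 + 1)) (q 0 + 1) (q 1 + 1) B L) : ℚ) ≤ E3M * C.NN₃ B L)
    (hD : ((C.SD₃ (q 0 + 1) (q 1 + 1) B L) : ℚ) ≤ ED * C.NN₃ B L)
    (t' t'' : ℝ) {U : ℝ} (hU : 0 ≤ U) {R : ℝ} (hR : 2 ≤ R) :
    (hubbardTT'T''FermionInteraction 1 t' t'' U).tiGroundEnergyDensityAt R ((((q 0 + 1) * (q 1 + 1) : ℕ) : ℝ)⁻¹ * N) ≤
      (((q 0 + 1) * (q 1 + 1) : ℕ) : ℝ)⁻¹ *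
        ((EK : ℝ) + max (t' * EP) (-t' * EM) + max (t'' * E3P) (-t'' * E3M) + U * ED) := by
  -- back to the plain forms
  set a := q 0 + 1 with ha
  set b := q 1 + 1 with hb
  rw [supp₅_eq] at hsupp
  rw [C.SHop₄_eq, C.SHop₃_eq _ hBL] at hK hP hM h3P h3M
  rw [C.SD₃_eq hBL] at hD
  rw [C.NN₃_eq hBL] at hNN hK hP hM h3P h3M hD
  have hs : allNat (fun m => decide (upCount (a * b) m + dnCount (a * b) m = N) || decide (C.fAt m = 0)) (4 ^ (a * b)) = true := by
    rw [supp₃, allNest_eq, hBL] at hsupp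
    simpa only [Nat.zero_add] using hsupp
  -- the normalised vector
  set φ : Fock (Orb (Fin a ×ₗ Fin b)) := codedVec C.fAt with hφ
  have hnorm : star φ ⬝ᵥ φ = ((C.NN a b : ℝ) : ℂ) := C.star_dotProduct_codedVec a b
  set c : ℝ := Real.sqrt (C.NN a b : ℝ)⁻¹ with hc
  have hNNpos : (0 : ℝ) < (C.NN a b : ℝ) := by exact_mod_cast hNN
  have hc2 : c ^ 2 = ((C.NN a b : ℝ))⁻¹ := by
    rw [hc, Real.sq_sqrt (inv_nonneg.2 hNNpos.le)]
  let ψ : Fock (Orb (Fin a ×ₗ Fin b)) := (c : ℂ) • φ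
  have hψφ : ∀ A : Matrix (Finset (Orb (Fin a ×ₗ Fin b))) (Finset (Orb (Fin a ×ₗ Fin b))) ℂ,
      star ψ ⬝ᵥ (A *ᵥ ψ) = ((c ^ 2 : ℝ) : ℂ) * (star φ ⬝ᵥ (A *ᵥ φ)) := by
    intro A
    simp only [ψ, star_smul, mulVec_smul, smul_dotProduct, dotProduct_smul, smul_eq_mul, RCLike.star_def,
      Complex.conj_ofReal]
    push_cast
    ring
  have hψ1 : star ψ ⬝ᵥ ψ = 1 := by
    have : star ψ ⬝ᵥ ψ = ((c ^ 2 : ℝ) : ℂ) * (star φ ⬝ᵥ φ) := by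
      simp only [ψ, star_smul, smul_dotProduct, dotProduct_smul, smul_eq_mul, RCLike.star_def, Complex.conj_ofReal]
      push_cast
      ring
    rw [this, hnorm, hc2, ← Complex.ofReal_mul, inv_mul_cancel₀ hNNpos.ne']
    simp
  have hψN : IsNParticle N ψ := by
    have hφN : IsNParticle N φ := isNParticle_codedVec C.fAt fun m hm => by
      have := of_allNat hs m hm
      rw [Bool.or_eq_true, decide_eq_true_eq, decide_eq_true_eq] at this
      exact this
    intro s hs'
    simp [ψ, hφN s hs']
  -- the five quadratic forms of ψ
  have form : ∀ (t₀ s₀ u₀ : ℝ), (star ψ ⬝ᵥ (hubbardOpenBoxTT' a b t₀ s₀ u₀ *ᵥ ψ)).re =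
      c ^ 2 * (-t₀ * C.SHop (nnAdjCode b) a b - s₀ * C.SHop (diagAdjCode b) a b + u₀ * C.SD a b) := by
    intro t₀ s₀ u₀
    rw [hψφ, C.star_dotProduct_mulVec_codedVec, ← Complex.ofReal_mul, Complex.ofReal_re]
  have form3 : (star ψ ⬝ᵥ (hamiltonian (rectBoxAxial2Graph a b) 1 0 *ᵥ ψ)).re = c ^ 2 * (-(C.SHop (ax2AdjCode b) a b : ℝ)) := by
    rw [hψφ, C.star_dotProduct_axial2_mulVec_codedVec, ← Complex.ofReal_mul, Complex.ofReal_re]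
  -- `X ≤ E · NN ⇒ c² X ≤ E`
  have key : ∀ {X E : ℝ}, X ≤ E * (C.NN a b : ℝ) → c ^ 2 * X ≤ E := by
    intro X E h1
    rw [hc2, inv_mul_le_iff₀ hNNpos]
    linarith [h1, mul_comm E (C.NN a b : ℝ)]
  have hKr : (star ψ ⬝ᵥ (hubbardOpenBoxTT' a b 1 0 0 *ᵥ ψ)).re ≤ EK := by
    rw [form]
    have h1 : (-(C.SHop (nnAdjCode b) a b : ℝ)) ≤ (EK : ℝ) * (C.NN a b : ℝ) := by exact_mod_cast hK
    refine le_trans (le_of_eq ?_) (key h1)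
    ring
  have hPr : (star ψ ⬝ᵥ (hubbardOpenBoxTT' a b 0 1 0 *ᵥ ψ)).re ≤ EP := by
    rw [form]
    have h1 : (-(C.SHop (diagAdjCode b) a b : ℝ)) ≤ (EP : ℝ) * (C.NN a b : ℝ) := by exact_mod_cast hP
    refine le_trans (le_of_eq ?_) (key h1)
    ring
  have hMr : (star ψ ⬝ᵥ (hubbardOpenBoxTT' a b 0 (-1) 0 *ᵥ ψ)).re ≤ EM := by
    rw [form]
    have h1 : ((C.SHop (diagAdjCode b) a b : ℝ)) ≤ (EM : ℝ) * (C.NN a b : ℝ) := by exact_mod_cast hM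
    refine le_trans (le_of_eq ?_) (key h1)
    ring
  have h3Pr : (star ψ ⬝ᵥ (hamiltonian (rectBoxAxial2Graph a b) 1 0 *ᵥ ψ)).re ≤ E3P := by
    rw [form3]
    have h1 : (-(C.SHop (ax2AdjCode b) a b : ℝ)) ≤ (E3P : ℝ) * (C.NN a b : ℝ) := by exact_mod_cast h3P
    exact key h1
  have h3Mr : -(star ψ ⬝ᵥ (hamiltonian (rectBoxAxial2Graph a b) 1 0 *ᵥ ψ)).re ≤ E3M := by
    rw [form3]
    have h1 : ((C.SHop (ax2AdjCode b) a b : ℝ)) ≤ (E3M : ℝ) * (C.NN a b : ℝ) := by exact_mod_cast h3M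
    refine le_trans (le_of_eq ?_) (key h1)
    ring
  have hDr : (star ψ ⬝ᵥ (hubbardOpenBoxTT' a b 0 0 1 *ᵥ ψ)).re ≤ ED := by
    rw [form]
    have h1 : ((C.SD a b : ℝ)) ≤ (ED : ℝ) * (C.NN a b : ℝ) := by exact_mod_cast hD
    refine le_trans (le_of_eq ?_) (key h1)
    ring
  exact tiGroundEnergyDensityAt_hubbardTT'T''_le_of_openBox_witness_planes q hU hR hψN hψ1 hKr hPr hMr h3Pr h3Mr hDr t' t''

end OccupationCode

end Literature.MathematicalPhysics.QuantumLattice
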